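import Literature.NumberTheory.DiophantineGeometry.SaturationIndexBound
import Summits.ABC.StewartYu.SatCoords
import Summits.ABC.StewartYu.GenThreeInductionTwo
import Mathlib.LinearAlgebra.Matrix.ToLinearEquiv
import HarnessLib

/-!
# Cell abc-stewartyu, WP-L.P (both parities): the SATURATION FRAME KIT — from the crux's generators `α` to
# the saturated basis `θ`, the change-of-basis matrix `C`, the index `N = |det C|`, the inverse relation
# `θᵢ^N = ∏ⱼ |αⱼ|^{Uᵢⱼ}` (`U = sign(det C)·adj C`), the transported coefficients `b̃ = b ᵥ* C`; and the `p = 2`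
# add-on `ϑ := θ²` (`≡ 1 (mod 8)`, `3`-Kummer, `α² = ϑ^C`)

`Summits/ABC/StewartYu/SatFrameKit.lean` — cell `abc-stewartyu` (HOME `run/shared/lean/pub/abc-stewartyu/`), seat p3
(g9), A1.L tranche of route `YuMatveevShapeRat` (cruxes r3 `PadicCoreOddRat` / r4 `PadicCoreTwoRat`); design memos
HOME/p2/memo-07 §1 (L1)–(L3), HOME/p3/memo-11 §1 (M1).  Theorems only; no definition, no named fact.

The 𝔑-threaded (Kummer-free) Gen-3 frames run the landed analytic machine on a SATURATED basis of the group
generated by the crux's rationals `α₁,…,αₙ` (Nesterenko 2003 §4.3: `θᵢ` with `log θᵢ = Σ uᵢⱼ log αⱼ`, `ū` a basis of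
`𝔑 = {λ ∈ ℚⁿ : α^λ ∈ ℚ}`; Cor 4.5: such a basis is Kummer for free), measuring every size through the VIRTUAL
`α`-coordinates (`SatCoords`, hypothesis `hU : θᵢ^N = ∏ⱼ αⱼ^{Uᵢⱼ}`).  This file SUPPLIES that hypothesis from the
Literature existence theorem `Dioph.exists_saturated_basis_rat_det_le` (`|αⱼ| = ∏ᵢ θᵢ^{C j i}`, `|det C| ≤ ∏ 2h(αⱼ)/log 2`):

* `mulIndep_abs` — `|α|` is multiplicatively independent when `α` is (any signs);
* `det_ne_zero_of_basisChange` — `det C ≠ 0` (independence of `|α|`); `vecMul_ne_zero_of_det_ne_zero` — `b ≠ 0 ⇒ b ᵥ* C ≠ 0`;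
* **`pow_natAbs_det_eq_prod_zpow`** — `θᵢ^{|det C|} = ∏ⱼ |αⱼ|^{(sign(det C)•adj C) i j}` (Cramer);
* (private) `three_le_padicValRat_sq_sub_one` — a rational `2`-adic unit has `ord₂(u² − 1) ≥ 3`; `padicValRat_eq_zero_of_pow`;
* **`exists_satFrame`** — the package for any parity: `θ > 0` independent and `q`-saturated up to sign for every `q`,
  `C`, `N = |det C| > 0`, `U` with `θᵢ^N = ∏ |αⱼ|^{Uᵢⱼ}`, `∏ θᵢ^{(b ᵥ* C)ᵢ} = ∏ |αⱼ|^{bⱼ}`, `N ≤ ∏ 2h(αⱼ)/log 2`,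
  and `ord_p θᵢ = 0` whenever all `ord_p αⱼ = 0`;
* **`exists_satFrame_two`** — the `p = 2` package (memo-11 (M1)): for `αⱼ ≡ 1 (mod 8)` independent, `ϑ := θ²` satisfies
  `3 ≤ ord₂(ϑᵢ − 1)`, independence, the `3`-Kummer condition in `ℤ`-divisibility form, `αⱼ² = ∏ ϑᵢ^{C j i}`,
  `ϑᵢ^N = ∏ (αⱼ²)^{Uᵢⱼ}`, `∏ ϑᵢ^{(b ᵥ* C)ᵢ} = (∏ αⱼ^{bⱼ})²` and `ord₂(∏ αⱼ^{bⱼ} − 1) ≤ ord₂(∏ ϑᵢ^{(b ᵥ* C)ᵢ} − 1)`.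

WHAT THIS IS NOT: no basis reduction (`SatBasisReduced`, R25 (3)); no analytic content; no crux moves (A1.L not moved).

References: Yu. V. Nesterenko, LNM 1819 (2003), §3.5 (p.105), §4.3 Lemma 4.4 / Cor 4.5 (p.122–123); K. Yu, Acta Math.
211 (2013) §1.1 p.319; HOME/p2/memo-07 §1, HOME/p3/memo-11 §1.
-/

noncomputable section

open Finset
open scoped Matrix

namespace Summit.ABC.StewartYu.SatFrameKit

variable {n : ℕ}

/-! ### Independence of the absolute values -/

/-- `(|a|^m)² = (a^m)²`. [folklore] -/
theorem sq_zpow_abs (a : ℚ) (m : ℤ) : (|a| ^ m) ^ 2 = (a ^ m) ^ 2 := by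
  rw [← abs_zpow, sq_abs]

/-- **`|α|` is multiplicatively independent when `α` is** (`∏ |αⱼ|^{μⱼ} = 1 ⇒ ∏ αⱼ^{2μⱼ} = 1`). [folklore] -/
theorem mulIndep_abs (α : Fin n → ℚ) (hind : ∀ μ : Fin n → ℤ, ∏ j, α j ^ μ j = 1 → μ = 0) :
    ∀ μ : Fin n → ℤ, ∏ j, |α j| ^ μ j = 1 → μ = 0 := by
  -- adapted from `Literature…KummerSaturated.exists_kummer_basis_rat_of_ne_zero`
  intro μ hμ
  have h2 : ∏ j, α j ^ (2 * μ j) = 1 := by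
    calc ∏ j, α j ^ (2 * μ j) = ∏ j, (|α j| ^ μ j) ^ 2 :=
          prod_congr rfl fun j _ => by rw [mul_comm, zpow_mul, zpow_ofNat, sq_zpow_abs]
      _ = (∏ j, |α j| ^ μ j) ^ 2 := prod_pow _ 2 _
      _ = 1 := by rw [hμ, one_pow]
  have := hind _ h2
  funext j
  have hj := congr_fun this j
  simp only [Pi.zero_apply, mul_eq_zero, OfNat.ofNat_ne_zero, false_or] at hj
  exact hj

/-! ### The change-of-basis matrix is non-singular; Cramer inversion -/

/-- **`det C ≠ 0`** when `aⱼ = ∏ᵢ θᵢ^{C j i}` with `a` multiplicatively independent: a non-zero integer vector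
`μ` with `μ ᵥ* C = 0` would give `∏ aⱼ^{μⱼ} = ∏ᵢ θᵢ^{(μ ᵥ* C)ᵢ} = 1`. [folklore] -/
theorem det_ne_zero_of_basisChange (a θ : Fin n → ℚ) (hθ : ∀ i, θ i ≠ 0)
    (haind : ∀ μ : Fin n → ℤ, ∏ j, a j ^ μ j = 1 → μ = 0)
    (C : Matrix (Fin n) (Fin n) ℤ) (hC : ∀ j, a j = ∏ i, θ i ^ C j i) : C.det ≠ 0 := by
  classical
  intro hdet
  obtain ⟨μ, hμ, hμC⟩ := Matrix.exists_vecMul_eq_zero_iff.mpr hdet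
  apply hμ
  apply haind μ
  rw [← SatCoords.prod_zpow_vecMul_eq a θ hθ C hC μ, hμC]
  simp

/-- `b ≠ 0 ⇒ b ᵥ* C ≠ 0` for a non-singular integer matrix. [folklore] -/
theorem vecMul_ne_zero_of_det_ne_zero (C : Matrix (Fin n) (Fin n) ℤ) (hdet : C.det ≠ 0)
    {b : Fin n → ℤ} (hb : b ≠ 0) : b ᵥ* C ≠ 0 := by
  classical
  intro h
  exact absurd (Matrix.exists_vecMul_eq_zero_iff.mp ⟨b, hb, h⟩) hdet

/-- The integer matrix `U = sign(det C) • adj C` satisfies `U * C = |det C| • 1`. [folklore] -/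
theorem sign_smul_adjugate_mul (C : Matrix (Fin n) (Fin n) ℤ) :
    (C.det.sign • C.adjugate) * C = (C.det.natAbs : ℤ) • (1 : Matrix (Fin n) (Fin n) ℤ) := by
  rw [Matrix.smul_mul, Matrix.adjugate_mul, smul_smul, Int.sign_mul_self_eq_abs, Int.abs_eq_natAbs]

/-- The same identity entrywise: `Σⱼ U i j · C j k = |det C|·δᵢₖ`. [folklore] -/
theorem sum_sign_smul_adjugate_mul (C : Matrix (Fin n) (Fin n) ℤ) (i k : Fin n) :
    ∑ j, (C.det.sign • C.adjugate) i j * C j k = if i = k then (C.det.natAbs : ℤ) else 0 := by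
  have h := congrFun (congrFun (sign_smul_adjugate_mul C) i) k
  rw [Matrix.mul_apply] at h
  rw [h, Matrix.smul_apply, Matrix.one_apply, smul_eq_mul, mul_ite, mul_one, mul_zero]

/-- **Cramer inversion of the change of basis**: if `aⱼ = ∏ᵢ θᵢ^{C j i}` (all `θᵢ ≠ 0`) then
`θᵢ^{|det C|} = ∏ⱼ aⱼ^{(sign(det C)•adj C) i j}` — the hypothesis `hU` of `SatCoords` with `N = |det C|`.
[cite: Nesterenko2003, §3.5 (p.105, N𝔑 ⊆ ℤⁿ); shape only] -/
theorem pow_natAbs_det_eq_prod_zpow (a θ : Fin n → ℚ) (hθ : ∀ i, θ i ≠ 0)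
    (C : Matrix (Fin n) (Fin n) ℤ) (hC : ∀ j, a j = ∏ i, θ i ^ C j i) (i : Fin n) :
    θ i ^ C.det.natAbs = ∏ j, a j ^ (C.det.sign • C.adjugate) i j := by
  classical
  rw [KummerBasisChange.prod_zpow_basisChange θ hθ (fun j k => C j k) a hC ((C.det.sign • C.adjugate) i)]
  have h : ∀ k, ∑ j, (C.det.sign • C.adjugate) i j * C j k = if i = k then (C.det.natAbs : ℤ) else 0 :=
    fun k => sum_sign_smul_adjugate_mul C i k
  simp_rw [h]
  rw [Finset.prod_eq_single i (fun k _ hk => by rw [if_neg (Ne.symm hk), zpow_zero])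
    (fun h => absurd (Finset.mem_univ i) h), if_pos rfl, zpow_natCast]

/-! ### `2`-adic units: squares are `≡ 1 (mod 8)` -/

/-- If `x^N` (`N ≠ 0`) is a `p`-adic unit then so is `x`. [folklore] -/
theorem padicValRat_eq_zero_of_pow {p : ℕ} [Fact p.Prime] {x : ℚ} {N : ℕ} (hN : N ≠ 0)
    (h : padicValRat p (x ^ N) = 0) : padicValRat p x = 0 := by
  rw [padicValRat.pow] at h
  rcases mul_eq_zero.mp h with h | h
  · exact absurd (by exact_mod_cast h) hN
  · exact h

/-- A product of integer powers of `p`-adic units is a `p`-adic unit. [folklore] -/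
theorem padicValRat_prod_zpow_eq_zero {p : ℕ} [Fact p.Prime] (a : Fin n → ℚ) (ha : ∀ j, a j ≠ 0)
    (hv : ∀ j, padicValRat p (a j) = 0) (U : Fin n → ℤ) : padicValRat p (∏ j, a j ^ U j) = 0 := by
  rw [Literature.Barriers.ABC.padicValRat_finset_prod _ _ fun j _ => zpow_ne_zero _ (ha j)]
  refine Finset.sum_eq_zero fun j _ => ?_
  rw [padicValRat.zpow, hv j, mul_zero]

/-- **Odd squares are `1 (mod 8)`**: for a rational `2`-adic unit `u` with `u² ≠ 1`, `3 ≤ ord₂(u² − 1)`.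
(Private copy: the same statement is `Literature.NumberTheory.EllipticCurves.Wiles2000.three_le_padicValRat_sq_sub_one`,
whose module would drag the elliptic-curve import cone under every WP-L.P(2) file.) [folklore] -/
private theorem three_le_padicValRat_sq_sub_one {u : ℚ} (hu : u ≠ 0) (hv : padicValRat 2 u = 0)
    (h1 : u ^ 2 - 1 ≠ 0) : 3 ≤ padicValRat 2 (u ^ 2 - 1) := by
  -- adapted from lp-1's private `three_le_padicValRat_two_sq_sub_one`
  -- (Literature/NumberTheory/DiophantineGeometry/ApproximationBoundRatPadicUnitsProofs.lean)
  haveI : Fact (Nat.Prime 2) := ⟨Nat.prime_two⟩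
  have hnum : u.num ≠ 0 := Rat.num_ne_zero.mpr hu
  have hv' := hv
  rw [padicValRat_def] at hv'
  have hden : ¬ 2 ∣ u.den := by
    intro hden
    have h1 : padicValNat 2 u.den ≠ 0 := by
      rw [Ne, padicValNat.eq_zero_iff]; push Not
      exact ⟨by norm_num, u.den_ne_zero, hden⟩
    have h2 : padicValInt 2 u.num ≠ 0 := by omega
    have h3 : (2 : ℤ) ∣ u.num := by
      by_contra h; exact h2 (padicValInt.eq_zero_of_not_dvd h)
    have h4 : 2 ∣ u.num.natAbs := Int.natAbs_dvd_natAbs.mpr h3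
    have h5 : 2 ∣ Nat.gcd u.num.natAbs u.den := Nat.dvd_gcd h4 hden
    rw [Nat.Coprime.gcd_eq_one u.reduced] at h5
    exact absurd (Nat.le_of_dvd one_pos h5) (by norm_num)
  have hnum2 : ¬ (2 : ℤ) ∣ u.num := by
    have h1 : padicValNat 2 u.den = 0 := padicValNat.eq_zero_of_not_dvd hden
    have h2 : padicValInt 2 u.num = 0 := by omega
    intro h
    rw [padicValInt.eq_zero_iff] at h2
    rcases h2 with h2 | h2 | h2
    · norm_num at h2
    · exact hnum h2
    · exact h2 h
  have hoddn : Odd u.num := Int.not_even_iff_odd.mp fun he => hnum2 (even_iff_two_dvd.mp he)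
  have hoddd : Odd (u.den : ℤ) := by
    rw [Int.odd_coe_nat]
    exact Nat.odd_iff.mpr (Nat.two_dvd_ne_zero.mp hden)
  -- `u² − 1 = (num² − den²)/den²`, `8 ∣ num² − den²`
  have h8 : (8 : ℤ) ∣ u.num ^ 2 - (u.den : ℤ) ^ 2 := by
    have ha := Int.eight_dvd_sq_sub_one_of_odd hoddn
    have hb := Int.eight_dvd_sq_sub_one_of_odd hoddd
    have : u.num ^ 2 - (u.den : ℤ) ^ 2 = (u.num ^ 2 - 1) - ((u.den : ℤ) ^ 2 - 1) := by ring
    rw [this]; exact dvd_sub ha hb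
  have hden0 : (u.den : ℚ) ≠ 0 := by exact_mod_cast u.den_ne_zero
  have hexpr : u ^ 2 - 1 = ((u.num ^ 2 - (u.den : ℤ) ^ 2 : ℤ) : ℚ) / ((u.den : ℚ) ^ 2) := by
    have hu' : u = (u.num : ℚ) / u.den := (Rat.num_div_den u).symm
    conv_lhs => rw [hu']
    push_cast
    field_simp
  have hz : (u.num ^ 2 - (u.den : ℤ) ^ 2 : ℤ) ≠ 0 := by
    intro h0
    apply h1
    rw [hexpr, h0]; simp
  have hvden : padicValRat 2 ((u.den : ℚ) ^ 2) = 0 := by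
    rw [padicValRat.pow, padicValRat.of_nat, padicValNat.eq_zero_of_not_dvd hden]; simp
  rw [hexpr, padicValRat.div (by exact_mod_cast hz) (pow_ne_zero _ hden0), hvden, sub_zero, padicValRat.of_int]
  have h3 : 3 ≤ padicValInt 2 (u.num ^ 2 - (u.den : ℤ) ^ 2) := by
    unfold padicValInt
    have h83 : 2 ^ 3 ∣ (u.num ^ 2 - (u.den : ℤ) ^ 2).natAbs := by
      have := Int.natAbs_dvd_natAbs.mpr h8
      simpa using this
    exact (padicValNat_dvd_iff_le (Int.natAbs_ne_zero.mpr hz)).mp h83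
  exact_mod_cast h3

/-! ### The package, any parity -/

/-- **THE SATURATION FRAME of a crux datum (any parity).**  For non-zero multiplicatively independent rationals
`α₁,…,αₙ`: a positive, independent basis `θ` of the saturation of `⟨|α₁|,…,|αₙ|⟩`, `q`-saturated up to sign for every
`q ≥ 1`, with change-of-basis matrix `C` (`|αⱼ| = ∏ θᵢ^{C j i}`), index `N = |det C| > 0` bounded by `∏ 2h(αⱼ)/log 2`,
the Cramer inverse `U` (`θᵢ^N = ∏ |αⱼ|^{U i j}` — the `hU` of `SatCoords`), the coefficient transport
`∏ θᵢ^{(b ᵥ* C)ᵢ} = ∏ |αⱼ|^{bⱼ}` with `b ᵥ* C ≠ 0` for `b ≠ 0`, and `p`-adic units stay units.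
[cite: Nesterenko2003, §3.5 and §4.3 Cor 4.5; shape only] -/
theorem exists_satFrame (α : Fin n → ℚ) (hα : ∀ j, α j ≠ 0)
    (hind : ∀ μ : Fin n → ℤ, ∏ j, α j ^ μ j = 1 → μ = 0) :
    ∃ (θ : Fin n → ℚ) (C U : Matrix (Fin n) (Fin n) ℤ) (N : ℕ),
      (∀ i, 0 < θ i) ∧
      (∀ μ : Fin n → ℤ, ∏ i, θ i ^ μ i = 1 → μ = 0) ∧
      (∀ q : ℕ, 0 < q → ∀ γ : ℚ, (∃ c : Fin n → ℤ, γ ^ q = ∏ i, θ i ^ c i) →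
        ∃ c : Fin n → ℤ, γ = ∏ i, θ i ^ c i ∨ -γ = ∏ i, θ i ^ c i) ∧
      (∀ j, |α j| = ∏ i, θ i ^ C j i) ∧
      0 < N ∧ (N : ℤ) = |C.det| ∧ (N : ℝ) ≤ ∏ j, (2 * Height.logHeight₁ (α j) / Real.log 2) ∧
      (∀ i, θ i ^ N = ∏ j, |α j| ^ U i j) ∧
      (∀ b : Fin n → ℤ, ∏ i, θ i ^ (b ᵥ* C) i = ∏ j, |α j| ^ b j) ∧
      (∀ b : Fin n → ℤ, b ≠ 0 → b ᵥ* C ≠ 0) ∧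
      (∀ p : ℕ, p.Prime → (∀ j, padicValRat p (α j) = 0) → ∀ i, padicValRat p (θ i) = 0) := by
  have habs : ∀ j, 0 < |α j| := fun j => abs_pos.mpr (hα j)
  have habs0 : ∀ j, |α j| ≠ 0 := fun j => (habs j).ne'
  have hind' := mulIndep_abs α hind
  obtain ⟨θ, C, hpos, hθind, hC, hsat, hdet⟩ :=
    Literature.NumberTheory.DiophantineGeometry.Dioph.exists_saturated_basis_rat_det_le (fun j => |α j|) habs hind'
  have hθ0 : ∀ i, θ i ≠ 0 := fun i => (hpos i).ne'
  have hdet0 : C.det ≠ 0 := det_ne_zero_of_basisChange (fun j => |α j|) θ hθ0 hind' C hC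
  set N : ℕ := C.det.natAbs with hN
  set U : Matrix (Fin n) (Fin n) ℤ := C.det.sign • C.adjugate with hUdef
  have hNpos : 0 < N := Int.natAbs_pos.mpr hdet0
  have hU : ∀ i, θ i ^ N = ∏ j, |α j| ^ U i j := fun i =>
    pow_natAbs_det_eq_prod_zpow (fun j => |α j|) θ hθ0 C hC i
  refine ⟨θ, C, U, N, hpos, hθind, hsat, hC, hNpos, Int.natCast_natAbs C.det, ?_, hU, ?_, ?_, ?_⟩
  · refine hdet.trans (le_of_eq (Finset.prod_congr rfl fun j _ => ?_))
    rw [Height.logHeight₁_eq_log_mulHeight₁, Height.logHeight₁_eq_log_mulHeight₁]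
    rcases abs_choice (α j) with h | h
    · rw [h]
    · rw [h, Height.mulHeight₁_neg]
  · intro b
    exact SatCoords.prod_zpow_vecMul_eq (fun j => |α j|) θ hθ0 C hC b
  · intro b hb
    exact vecMul_ne_zero_of_det_ne_zero C hdet0 hb
  · intro p hp hunit i
    haveI : Fact p.Prime := ⟨hp⟩
    have habs' : ∀ j, padicValRat p (|α j|) = 0 := by
      intro j
      rcases abs_choice (α j) with h | h
      · rw [h]; exact hunit j
      · rw [h, padicValRat.neg]; exact hunit j
    have h1 : padicValRat p (θ i ^ N) = 0 := by
      rw [hU i]; exact padicValRat_prod_zpow_eq_zero _ habs0 habs' _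
    exact padicValRat_eq_zero_of_pow hNpos.ne' h1

/-! ### The `p = 2` package: `ϑ := θ²` -/

/-- `∏ (θᵢ²)^{cᵢ} = (∏ θᵢ^{cᵢ})²`. [folklore] -/
theorem prod_sq_zpow (θ : Fin n → ℚ) (c : Fin n → ℤ) : ∏ i, (θ i ^ 2) ^ c i = (∏ i, θ i ^ c i) ^ 2 := by
  rw [← Finset.prod_pow]
  refine Finset.prod_congr rfl fun i _ => ?_
  rw [← zpow_natCast, ← zpow_natCast, ← zpow_mul, ← zpow_mul, mul_comm]

/-- **THE SATURATION FRAME at `p = 2` (memo-11 (M1)).**  For independent rationals `αⱼ ≡ 1 (mod 8)`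
(`3 ≤ ord₂(αⱼ − 1)`): with `θ, C, U, N` as in `exists_satFrame` and `ϑᵢ := θᵢ²`:
`3 ≤ ord₂(ϑᵢ − 1)`, `ϑ` independent, the `3`-Kummer condition `∏ ϑᵢ^{κᵢ} = γ³ ⇒ 3 ∣ κᵢ`, `αⱼ² = ∏ ϑᵢ^{C j i}`,
`ϑᵢ^N = ∏ (αⱼ²)^{U i j}`, `∏ ϑᵢ^{(b ᵥ* C)ᵢ} = (∏ αⱼ^{bⱼ})²`, `b ᵥ* C ≠ 0` for `b ≠ 0`, and the valuation comparison
`ord₂(∏ αⱼ^{bⱼ} − 1) ≤ ord₂(∏ ϑᵢ^{(b ᵥ* C)ᵢ} − 1)` (for `b ≠ 0`); `N ≤ ∏ 2h(αⱼ)/log 2`, `h(αⱼ²) = 2h(αⱼ)`,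
`h(ϑᵢ) = 2h(θᵢ)`. [cite: Nesterenko2003, §4.3 Cor 4.5; shape only] [cite: Yu2013, §1.1 p.319; shape only] -/
theorem exists_satFrame_two (α : Fin n → ℚ) (hα : ∀ j, 3 ≤ padicValRat 2 (α j - 1))
    (hind : ∀ μ : Fin n → ℤ, ∏ j, α j ^ μ j = 1 → μ = 0) :
    ∃ (ϑ : Fin n → ℚ) (C U : Matrix (Fin n) (Fin n) ℤ) (N : ℕ),
      (∀ i, 0 < ϑ i) ∧
      (∀ i, 3 ≤ padicValRat 2 (ϑ i - 1)) ∧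
      (∀ μ : Fin n → ℤ, ∏ i, ϑ i ^ μ i = 1 → μ = 0) ∧
      (∀ (κ : Fin n → ℤ) (γ : ℚ), ∏ i, ϑ i ^ κ i = γ ^ 3 → ∀ i, (3 : ℤ) ∣ κ i) ∧
      (∀ j, α j ^ 2 = ∏ i, ϑ i ^ C j i) ∧
      0 < N ∧ (N : ℤ) = |C.det| ∧ (N : ℝ) ≤ ∏ j, (2 * Height.logHeight₁ (α j) / Real.log 2) ∧
      (∀ i, ϑ i ^ N = ∏ j, (α j ^ 2) ^ U i j) ∧
      (∀ b : Fin n → ℤ, ∏ i, ϑ i ^ (b ᵥ* C) i = (∏ j, α j ^ b j) ^ 2) ∧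
      (∀ b : Fin n → ℤ, b ≠ 0 → b ᵥ* C ≠ 0) ∧
      (∀ b : Fin n → ℤ, b ≠ 0 →
        padicValRat 2 (∏ j, α j ^ b j - 1) ≤ padicValRat 2 (∏ i, ϑ i ^ (b ᵥ* C) i - 1)) := by
  haveI : Fact (Nat.Prime 2) := ⟨Nat.prime_two⟩
  have hα0 : ∀ j, α j ≠ 0 := fun j => TwoSetup.ne_zero_of_three_le (hα j)
  have hαv : ∀ j, padicValRat 2 (α j) = 0 := fun j =>
    GenThreeInductionTwo.padicValRat_eq_zero_of_three_le (hα j)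
  obtain ⟨θ, C, U, N, hpos, hθind, hsat, hC, hNpos, hNdet, hNle, hU, hbC, hbne, hunit⟩ :=
    exists_satFrame α hα0 hind
  have hθ0 : ∀ i, θ i ≠ 0 := fun i => (hpos i).ne'
  have hθv : ∀ i, padicValRat 2 (θ i) = 0 := hunit 2 Nat.prime_two hαv
  set ϑ : Fin n → ℚ := fun i => θ i ^ 2 with hϑ
  have hϑpos : ∀ i, 0 < ϑ i := fun i => pow_pos (hpos i) 2
  have hϑ0 : ∀ i, ϑ i ≠ 0 := fun i => (hϑpos i).ne'
  -- independence of `ϑ`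
  have hϑind : ∀ μ : Fin n → ℤ, ∏ i, ϑ i ^ μ i = 1 → μ = 0 := by
    intro μ hμ
    have h2 : ∏ i, θ i ^ (2 * μ i) = 1 := by
      calc ∏ i, θ i ^ (2 * μ i) = ∏ i, (θ i ^ 2) ^ μ i :=
            prod_congr rfl fun i _ => by rw [zpow_mul]; norm_cast
        _ = 1 := hμ
    have := hθind _ h2
    funext i
    have hi := congr_fun this i
    simp only [Pi.zero_apply, mul_eq_zero, OfNat.ofNat_ne_zero, false_or] at hi
    exact hi
  -- `3`-saturation of `θ` without sign (cubes of rationals keep the sign)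
  have hsat3 : ∀ γ : ℚ, (∃ c : Fin n → ℤ, γ ^ 3 = ∏ i, θ i ^ c i) → ∃ c : Fin n → ℤ, γ = ∏ i, θ i ^ c i := by
    rintro γ ⟨c, hc⟩
    obtain ⟨c', hc' | hc'⟩ := hsat 3 (by norm_num) γ ⟨c, hc⟩
    · exact ⟨c', hc'⟩
    · exfalso
      have hγpos : 0 < γ := by
        have h3 : 0 < γ ^ 3 := by rw [hc]; exact prod_pos fun i _ => zpow_pos (hpos i) _
        exact (Odd.pow_pos_iff (by decide : Odd 3)).mp h3
      have : 0 < -γ := by rw [hc']; exact prod_pos fun i _ => zpow_pos (hpos i) _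
      linarith
  -- the coefficient transport `∏ ϑᵢ^{(b ᵥ* C)ᵢ} = (∏ αⱼ^{bⱼ})²`
  have htrans : ∀ b : Fin n → ℤ, ∏ i, ϑ i ^ (b ᵥ* C) i = (∏ j, α j ^ b j) ^ 2 := by
    intro b
    show ∏ i, (θ i ^ 2) ^ (b ᵥ* C) i = _
    rw [prod_sq_zpow, hbC b, ← prod_sq_zpow, ← prod_sq_zpow]
    exact prod_congr rfl fun j _ => by rw [sq_abs]
  refine ⟨ϑ, C, U, N, hϑpos, ?_, hϑind, ?_, ?_, hNpos, hNdet, hNle, ?_, htrans, hbne, ?_⟩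
  · -- `ϑᵢ ≡ 1 (mod 8)`
    intro i
    have h1 : θ i ^ 2 - 1 ≠ 0 := by
      intro h0
      have hsq : θ i ^ 2 = 1 := sub_eq_zero.mp h0
      have hone : ∏ k, θ k ^ (Pi.single i 2 : Fin n → ℤ) k = 1 := by
        rw [Finset.prod_eq_single i (fun k _ hk => by rw [Pi.single_eq_of_ne hk, zpow_zero])
          (fun h => absurd (Finset.mem_univ i) h), Pi.single_eq_same]
        exact_mod_cast hsq
      have := congr_fun (hθind _ hone) i
      simp at this
    exact three_le_padicValRat_sq_sub_one (hθ0 i) (hθv i) h1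
  · -- `3`-Kummer in `ℤ`-divisibility form
    intro κ γ h i
    have h2 : ∏ k, θ k ^ (2 * κ k) = γ ^ 3 := by
      calc ∏ k, θ k ^ (2 * κ k) = ∏ k, (θ k ^ 2) ^ κ k :=
            prod_congr rfl fun k _ => by rw [zpow_mul]; norm_cast
        _ = γ ^ 3 := h
    have h3 := Literature.NumberTheory.DiophantineGeometry.KummerSaturated.three_dvd_of_prod_zpow_eq_cube_rat
      hθ0 hθind hsat3 h2 i
    have h32 : IsCoprime (3 : ℤ) 2 := by norm_num [Int.isCoprime_iff_gcd_eq_one]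
    exact h32.dvd_of_dvd_mul_left h3
  · -- `αⱼ² = ∏ ϑᵢ^{C j i}`
    intro j
    show α j ^ 2 = ∏ i, (θ i ^ 2) ^ C j i
    rw [prod_sq_zpow, ← hC j, sq_abs]
  · -- `ϑᵢ^N = ∏ (αⱼ²)^{U i j}`
    intro i
    calc ϑ i ^ N = (θ i ^ N) ^ 2 := by show (θ i ^ 2) ^ N = _; ring
      _ = (∏ j, |α j| ^ U i j) ^ 2 := by rw [hU i]
      _ = ∏ j, (|α j| ^ 2) ^ U i j := (prod_sq_zpow _ _).symm
      _ = ∏ j, (α j ^ 2) ^ U i j := prod_congr rfl fun j _ => by rw [sq_abs]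
  · -- valuation comparison `ord₂(x − 1) ≤ ord₂(x² − 1)`
    intro b hb
    have hx0 : ∏ j, α j ^ b j ≠ 0 := prod_ne_zero_iff.mpr fun j _ => zpow_ne_zero _ (hα0 j)
    have hxv : padicValRat 2 (∏ j, α j ^ b j) = 0 := padicValRat_prod_zpow_eq_zero α hα0 hαv b
    have hne1 : ∏ j, α j ^ b j ≠ 1 := fun h => hb (hind b h)
    have hne_neg : ∏ j, α j ^ b j ≠ -1 := by
      intro hneg
      have h3 := GenThreeInductionTwo.three_le_padicValRat_prod_zpow_sub_one α hα b hne1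
      rw [hneg, show ((-1 : ℚ) - 1) = -2 by norm_num, padicValRat.neg] at h3
      have h2 : padicValRat 2 (2 : ℚ) = 1 := by
        have := padicValRat.self (p := 2) one_lt_two
        simpa using this
      rw [h2] at h3
      exact absurd h3 (by norm_num)
    have hsq : (∏ j, α j ^ b j) ^ (2 : ℤ) ≠ 1 := by
      intro h
      have h' : (∏ j, α j ^ b j) * (∏ j, α j ^ b j) = 1 := by
        rw [← sq]; exact_mod_cast h
      rcases mul_self_eq_one_iff.mp h' with h1 | h1
      · exact hne1 h1
      · exact hne_neg h1
    have hle := Literature.Barriers.ABC.padicValRat_sub_one_le_zpow_sub_one hx0 hxv (n := 2) two_ne_zero hsq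
    rw [htrans b, ← zpow_ofNat]
    exact_mod_cast hle

end Summit.ABC.StewartYu.SatFrameKit

end
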